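import Literature.AlgebraicGeometry.Frobenioids.PerfectionEndomorphisms
import Literature.AlgebraicGeometry.Frobenioids.PerfectionCoAngularDivisorsOver
import HarnessLib

/-!
# Frobenioids I, Proposition 3.2 (i) / 5.5 (i) for THE perfection: `Base`, `deg_Fr`, `Div` and `x = (ε^*)⁻¹ Div ε`
# of the endomorphisms `O^▷((A, n))` of `C^pf` in terms of `O^▷(A^{(c)})` (PROOFS)

Mochizuki, *The geometry of Frobenioids I: the general theory*, Kyushu J. Math. **62** (2008)
293–400, Definition 3.1 (iii) p. 57, Proposition 3.2 (i) p. 58, Proposition 5.5 (i) p. 104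
[cite: MochizukiFrdI2008, Prop. 3.2 (i) p.58]: the operations of `C^pf → F_{Φ^pf}` on the class `[θ]` of an
endomorphism `θ : A^{(c)} → A^{(c)}` of `C` (`Perfection.endClass`, seat abc-iut-L1-d9): `deg_Fr[θ] = deg_Fr θ`,
`Base[θ] = Base(frob) ≫ Base θ ≫ Base(frob)⁻¹`, `Div[θ] = ((frob_{A,c})^* Div θ)^{1/(n·c)} ∈ Φ(Base A)^pf`; hence
every `ε ∈ O^▷((A, n))` has zero divisor AND invariant `(ε^*)⁻¹ Div ε` of that shape for some
`θ ∈ O^▷(A^{(c)})` — the dictionary the criterion of [EtTh] Cor. 3.8 (proof p.81, "pre-steps … abstractly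
equivalent to an endomorphism that belongs to '`O^▷(−)`'") reads `O^▷` of the perfection through.

PROOF-ONLY over L1's `Perfection*` chain (abc-iut cell; support for the row «EtTh:Cor3.8(i)/C38-L05», sub-row
L05c; seat abc-iut-w5-d246).  No new definitions; nothing here is specific to the abc programme.
-/

namespace Literature.AlgebraicGeometry.Frobenioids

namespace PreFrobenioid

namespace Perfection

open CategoryTheory Opposite

universe w v v' u u'

variable {D : Type u} [Category.{v} D] {Φ : Dᵒᵖ ⥤ CommMonCat.{w}}
  {C : Type u'} [Category.{v'} C] {F : C ⥤ ElemFrobenioid Φ} {hF : IsFrobenioid F} (X : Perfection hF)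

/-! ### The operations on a class `[θ]` -/

/-- `deg_Fr[θ] = deg_Fr(θ)`. [cite: MochizukiFrdI2008, Prop. 3.2 (i) p.58] -/
theorem degFr_endClass (c : ℕ+) (θ : frobPow hF X.obj c ⟶ frobPow hF X.obj c) :
    (ops hF).degFr (endClass X c θ) = PreFrobenioid.degFr F θ := rfl

/-- `Base[θ] = Base(frob_{A,c}) ≫ Base(θ) ≫ Base(frob_{A,c})⁻¹`. [cite: MochizukiFrdI2008, Prop. 3.2 (i) p.58] -/
theorem base_map_endClass (c : ℕ+) (θ : frobPow hF X.obj c ⟶ frobPow hF X.obj c) :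
    (ops hF).base.map (endClass X c θ) = Base F (frob hF X.obj c) ≫ Base F θ ≫ baseInvFrob hF X.obj c := rfl

/-- `Div[θ] = ((frob_{A,c})^* Div θ)^{1/(n·c)}` in `Φ(Base A)^pf`. [cite: MochizukiFrdI2008, Prop. 3.2 (i) p.58] -/
theorem div_endClass (c : ℕ+) (θ : frobPow hF X.obj c ⟶ frobPow hF X.obj c) :
    (ops hF).div (endClass X c θ) =
      Frobenioids.Perfection.mk (pull Φ (Base F (frob hF X.obj c)) (Div F θ)) (X.idx * c) := rfl

/-- For a base-identity `θ`, the invariant `([θ]^*)⁻¹ Div[θ]` (for the structure functor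
`(Perfection.ops hF).toFunctor`) is `Div[θ] = ((frob_{A,c})^* Div θ)^{1/(n·c)}`.
[cite: MochizukiFrdI2008, Def. 1.3 (iii) p.24] -/
theorem invDiv_endClass (c : ℕ+) (θ : frobPow hF X.obj c ⟶ frobPow hF X.obj c) (hθ : IsBaseIdentity F θ)
    (h : IsBaseIso (ops hF).toFunctor (endClass X c θ)) :
    invDiv (ops hF).toFunctor (endClass X c θ) h =
      Frobenioids.Perfection.mk (pull Φ (Base F (frob hF X.obj c)) (Div F θ)) (X.idx * c) :=
  invDiv_eq_of_pull_eq _ h (by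
    rw [show Base (ops hF).toFunctor (endClass X c θ) = 𝟙 _ from (isBaseIdentity_endClass_iff X c θ).mpr hθ,
      pull_id]
    rfl)

/-! ### Elements of `O^▷((A, n))` -/

/-- **Every `ε ∈ O^▷((A, n))` is `[θ]` for some `θ ∈ O^▷(A^{(c)})`, with `Div ε = ((frob_{A,c})^* Div θ)^{1/(n·c)}`.**
[cite: MochizukiFrdI2008, Prop. 5.5 (i) p.104] -/
theorem exists_endClass_of_mem_endSubmonoid (ε : X ⟶ X) (hε : (ε : End X) ∈ (ops hF).endSubmonoid X) :
    ∃ (c : ℕ+) (θ : End (frobPow hF X.obj c)), θ ∈ endSubmonoid F (frobPow hF X.obj c) ∧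
      endClass X c (End.asHom θ) = ε ∧
        (ops hF).div ε =
          Frobenioids.Perfection.mk (pull Φ (Base F (frob hF X.obj c)) (Div F (End.asHom θ))) (X.idx * c) := by
  obtain ⟨c, θ, hθ, h⟩ := exists_endClassHom_eq_of_mem X hε
  have h' : endClass X c (End.asHom θ) = ε := h
  exact ⟨c, θ, hθ, h', by rw [← h']; rfl⟩

/-- The invariant `(ε^*)⁻¹ Div ε` of `ε ∈ O^▷((A, n))` (a base-identity linear endomorphism of `(A, n)` is a
pre-step of `C^pf`): it is `((frob_{A,c})^* Div θ)^{1/(n·c)}` for some `θ ∈ O^▷(A^{(c)})` with `[θ] = ε`.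
[cite: MochizukiFrdI2008, Def. 1.3 (iii) p.24] -/
theorem exists_invDiv_eq_of_mem_endSubmonoid (ε : X ⟶ X) (hε : (ε : End X) ∈ (ops hF).endSubmonoid X)
    (h : IsBaseIso (ops hF).toFunctor ε) :
    ∃ (c : ℕ+) (θ : End (frobPow hF X.obj c)), θ ∈ endSubmonoid F (frobPow hF X.obj c) ∧
      endClass X c (End.asHom θ) = ε ∧
        invDiv (ops hF).toFunctor ε h =
          Frobenioids.Perfection.mk (pull Φ (Base F (frob hF X.obj c)) (Div F (End.asHom θ))) (X.idx * c) := by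
  obtain ⟨c, θ, hθ, hc⟩ := exists_endClassHom_eq_of_mem X hε
  have h' : endClass X c (End.asHom θ) = ε := hc
  subst h'
  exact ⟨c, θ, hθ, rfl, invDiv_endClass X c (End.asHom θ) hθ.1 h⟩

/-- Conversely every `θ ∈ O^▷(A^{(c)})` gives the element `[θ] ∈ O^▷((A, n))` with
`Div[θ] = ((frob_{A,c})^* Div θ)^{1/(n·c)}`. [cite: MochizukiFrdI2008, Prop. 5.5 (i) p.104] -/
theorem endClass_mem_endSubmonoid (c : ℕ+) {θ : End (frobPow hF X.obj c)}
    (hθ : θ ∈ endSubmonoid F (frobPow hF X.obj c)) :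
    End.of (endClass X c (End.asHom θ)) ∈ (ops hF).endSubmonoid X :=
  (endClassHom_mem_iff X c θ).mpr hθ

end Perfection

end PreFrobenioid

end Literature.AlgebraicGeometry.Frobenioids
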